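import Literature.NumberTheory.GaloisRepresentations.TateDualLimitDualConditionLevels
import Literature.NumberTheory.GaloisRepresentations.PontryaginTateDualInverseLimitEquivariance
import Literature.NumberTheory.GaloisRepresentations.GaloisH1MapBijectiveUnramified
import Literature.NumberTheory.IwasawaTheory.Greenberg2016.SelmerGroupStructure
import HarnessLib

/-!
# The level sets `Ш¹ᴰ_k ≤ H¹(Γ_K, Hom(D_k, μ_{p^k}))` of `Ш¹(K, Σ, T*)`: stability and the limit-to-level
# reading (definitions with bodies + theorems)

Topic `NumberTheory/IwasawaTheory/Greenberg2016`; namespace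
`Literature.NumberTheory.IwasawaTheory.Greenberg2016`.  One definition WITH BODY and theorems; no named
fact, no `sorry`, no instance, no notation.  Lane «SUR-Λ» of cell `bsd-eis` (road memo
`SUR-LAMBDA-ROAD-w5g9.md` §2 ★(γ) / §8, brick C7b part 3 = the instantiation of the abstract level sets
`Sh1 k` of `ShaOneDualTorsionOfShaDuality` and the reading «`y ∈ Ш¹(K, Σ, T*)` ⟹ `y_k ∈ Ш¹ᴰ_k`»),
`--supports stmt-BirchSwinnertonDyer-19032`.

For a discrete `Γ_K`-module `τ` on `D`, a `TorsionLayers` structure `E` (levels `D_k = E.N k`, duals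
`E.layerDualRep k = Hom(D_k, μ_{p^k})`, compact dual `T* = lim← Hom(D_k, μ_{p^k})`) and a set `S` of
finite places (`Σ = S ∪ {v | ∞}`, `InSigma S`):

* `shaOneDualLevel S E k = Ш¹ᴰ_k` — the classes of `H¹(Γ_K, Hom(D_k, μ_{p^k}))` whose localisation
  VANISHES at every `v ∈ Σ` and is UNRAMIFIED at every finite `w ∉ S` (the level-`k` restricted
  Tate–Shafarevich group `Ш¹(G_Σ, D_k^*(1))` read in `H¹(Γ_K, ·)`);
* `cohomologyMap_mem_shaOneDualLevel` — `Ш¹ᴰ_•` is stable under `H¹(F)` for EVERY morphism of layers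
  `F : Hom(D_m, μ) → Hom(D_k, μ)` (localisation commutes with `H¹(F)`, the tree's `localization_map_one`,
  and `H¹(F_w)` preserves unramified classes, the tree's `map_unramifiedSubgroup_le`); in particular under
  the dual transitions (`redHom_mem_shaOneDualLevel`) and the dual endomorphisms `r̂_k`
  (`layerDualEndHom_mem_shaOneDualLevel`) — the stability inputs `red_mem` / `hend` of
  `IsShaDualityTower` / `exists_nonZeroDivisor_dualEndHom_eq_zero_of_LEO`;
* **`projHom_mem_shaOneDualLevel`** — if `loc_v y = 0` for `v ∈ Σ` and `loc_w y ∈ H¹_ur(K_w, D)^⊥` for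
  the finite `w ∉ S` (membership of `y ∈ H¹_cont(Γ_K, T*)` in Greenberg's `Ш¹(K, Σ, T*)`, the tree's
  `dualSha`), then every level component `y_k = H¹(proj_k) y` lies in `Ш¹ᴰ_k` (levelwise reading of the
  `Λ`-adic dual local condition, the tree's `locDual_mem_dualLocalCondition_iff`, plus «unramified
  classes are the exact annihilator of unramified classes» `UnramifiedOrthogonal` at `w ∤ p`, GRANTED as
  the hypothesis `hUO` exactly as in `sum_limitPairing_eq_zero_of_level`).

HONESTY: plumbing for Greenberg 2010 Prop. 3.2.1 (γ); no duality and nothing about BSD is proved here.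
AI formalisation, weaker than expert review; the statements are established only by the kernel check.

## References
* R. Greenberg, *Surjectivity of the global-to-local map defining a Selmer group*, Kyoto J. Math.
  50 (2010) 853–888, §2.1 p. 7 L10–14 (`Ш¹(K, Σ, T*)`), §3.1 p. 14. [Greenberg2010]
* J. S. Milne, *Arithmetic Duality Theorems*, 2nd ed. (2006), I §2 (unramified cohomology),
  I Thm. 2.6. [MilneADT2006]
-/

noncomputable section

open scoped Classical
open Function CategoryTheory NumberField IsDedekindDomain Field
open _root_.TopRep _root_.ContRepresentation _root_.ContinuousCohomology
open Literature.NumberTheory.GaloisRepresentations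
open Literature.NumberTheory.GaloisRepresentations.DiscreteGaloisModule
open Literature.NumberTheory.GaloisRepresentations.DiscreteGaloisModule.TorsionLayers
open Literature.NumberTheory.GaloisCohomology
open Literature.NumberTheory.EllipticCurves.DiscreteGaloisModule

namespace Literature.NumberTheory.IwasawaTheory.Greenberg2016

variable {K : Type} [Field K] [NumberField K] (S : Set (HeightOneSpectrum (𝓞 K)))
  {D : Type} [AddCommGroup D] [TopologicalSpace D] [DiscreteTopology D]
  {τ : DiscreteGaloisModule K D} {p : ℕ} (E : τ.TorsionLayers p)

/-- **`Ш¹ᴰ_k`** — the classes of `H¹(Γ_K, Hom(D_k, μ_{p^k}))` that are locally `0` at every place of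
`Σ = S ∪ {v | ∞}` and unramified at every finite place outside `S` (the level-`k` restricted
Tate–Shafarevich group of the dual layer). [cite: Greenberg2010, §2.1 p. 7 L10–14]
[cite: MilneADT2006, Ch. I §4 (`Ш¹_S`)] -/
def shaOneDualLevel (k : ℕ) : AddSubgroup (galoisCohomology (E.layerDualRep k) 1) where
  carrier := {z |
    (∀ v : Place K, InSigma S v → galoisCohomology.localization (E.layerDualRep k) v 1 z = 0) ∧
    ∀ w : HeightOneSpectrum (𝓞 K), w ∉ S →
      galoisCohomology.localization (E.layerDualRep k) (Sum.inr w) 1 z ∈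
        unramifiedSubgroup (GaloisRep.toLocal w (E.layerDualRep k)) 1}
  zero_mem' := ⟨fun v _ => map_zero _, fun w _ => by rw [map_zero]; exact AddSubgroup.zero_mem _⟩
  add_mem' := fun {a b} ha hb =>
    ⟨fun v hv => by rw [map_add, ha.1 v hv, hb.1 v hv, add_zero],
      fun w hw => by rw [map_add]; exact AddSubgroup.add_mem _ (ha.2 w hw) (hb.2 w hw)⟩
  neg_mem' := fun {a} ha =>
    ⟨fun v hv => by rw [map_neg, ha.1 v hv, neg_zero],
      fun w hw => by rw [map_neg]; exact AddSubgroup.neg_mem _ (ha.2 w hw)⟩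

/-- Membership in `Ш¹ᴰ_k`. [cite: Greenberg2010, §2.1 p. 7 L10–14] -/
theorem mem_shaOneDualLevel_iff (k : ℕ) (z : galoisCohomology (E.layerDualRep k) 1) :
    z ∈ shaOneDualLevel S E k ↔
      (∀ v : Place K, InSigma S v → galoisCohomology.localization (E.layerDualRep k) v 1 z = 0) ∧
      ∀ w : HeightOneSpectrum (𝓞 K), w ∉ S →
        galoisCohomology.localization (E.layerDualRep k) (Sum.inr w) 1 z ∈
          unramifiedSubgroup (GaloisRep.toLocal w (E.layerDualRep k)) 1 :=
  Iff.rfl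

/-! ### Stability under morphisms of layers -/

/-- **`Ш¹ᴰ_•` is stable under `H¹(F)` for every morphism of dual layers `F`** (localisation commutes
with `H¹(F)`; `H¹(F_w)` preserves unramified classes). [cite: MilneADT2006, Ch. I §2 (unramified cohomology)]
[cite: SerreGaloisCohomology1997, I §2.4] -/
theorem cohomologyMap_mem_shaOneDualLevel {k m : ℕ}
    (F : (E.layerDualRep m).toTopRep ⟶ (E.layerDualRep k).toTopRep)
    {z : galoisCohomology (E.layerDualRep m) 1} (hz : z ∈ shaOneDualLevel S E m) :
    cohomologyMap F 1 z ∈ shaOneDualLevel S E k := by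
  have hnat : ∀ v : Place K, galoisCohomology.localization (E.layerDualRep k) v 1 (cohomologyMap F 1 z) =
      galoisCohomology.map (localMap F.hom v) 1 (galoisCohomology.localization (E.layerDualRep m) v 1 z) :=
    fun v => localization_map_one F.hom v z
  refine ⟨fun v hv => ?_, fun w hw => ?_⟩
  · rw [hnat v, hz.1 v hv, map_zero]
  · rw [hnat]
    exact galoisCohomology.map_unramifiedSubgroup_le (τ := GaloisRep.toLocal w (E.layerDualRep m))
      (τ' := GaloisRep.toLocal w (E.layerDualRep k)) (localMap F.hom (Sum.inr w)) ⟨_, hz.2 w hw, rfl⟩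

/-- `Ш¹ᴰ_•` is stable under the dual transitions `Hom(D_m, μ) → Hom(D_k, μ)` (`k ≤ m`) — the input
`red_mem` of `IsShaDualityTower`. [cite: Greenberg2010, §2.1 p. 7] -/
theorem redHom_mem_shaOneDualLevel {k m : ℕ} (h : k ≤ m)
    {z : galoisCohomology (E.layerDualRep m) 1} (hz : z ∈ shaOneDualLevel S E m) :
    cohomologyMap (E.dualSystem.redHom h) 1 z ∈ shaOneDualLevel S E k :=
  cohomologyMap_mem_shaOneDualLevel S E (E.dualSystem.redHom h) hz

/-- `Ш¹ᴰ_k` is stable under the dual endomorphisms `θ̂_k` of a `Γ_K`-equivariant, layer-preserving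
`θ` — the input `hend` of `exists_nonZeroDivisor_dualEndHom_eq_zero_of_LEO`. [cite: Greenberg2010, §2.1 p. 7] -/
theorem layerDualEndHom_mem_shaOneDualLevel (θ : D →+ D) (hθ : ∀ k, ∀ d ∈ E.N k, θ d ∈ E.N k)
    (hθτ : ∀ (σ : absoluteGaloisGroup K) (d : D), θ (τ σ d) = τ σ (θ d)) (k : ℕ)
    {z : galoisCohomology (E.layerDualRep k) 1} (hz : z ∈ shaOneDualLevel S E k) :
    cohomologyMap (E.layerDualEndHom θ hθ hθτ k) 1 z ∈ shaOneDualLevel S E k :=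
  cohomologyMap_mem_shaOneDualLevel S E (E.layerDualEndHom θ hθ hθτ k) hz

/-! ### From `Ш¹(K, Σ, T*)` to the levels -/

/-- **`y ∈ Ш¹(K, Σ, T*) ⟹ y_k ∈ Ш¹ᴰ_k` for every `k`**: if `loc_v y = 0` for `v ∈ Σ` and
`loc_w y ∈ H¹_ur(K_w, D)^⊥` for the finite `w ∉ S` (for the `Λ`-adic local pairing of a family `inv`
obeying the level-change law off `S`), then every level component `y_k` is locally `0` on `Σ`
(`(loc_v y)_k = loc_v (y_k)`) and unramified off `S` (levelwise reading of `H¹_ur(K_w, D)^⊥`, then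
`H¹_ur(K_w, D_k)^⊥ = H¹_ur(K_w, D_k^*(1))` for `w ∤ p` unramified in `D_k` — GRANTED as `hUO`).
[cite: Greenberg2010, §2.1 p. 7 L10–14, §3.1 p. 14 L24–26] [cite: MilneADT2006, Ch. I, Thm. 2.6] -/
theorem projHom_mem_shaOneDualLevel [CompactSpace (absoluteGaloisGroup K)] [NeZero p] [∀ k, Finite (E.N k)]
    (inv : ∀ k : ℕ, LocalInvariants K (p ^ k))
    (hinv : ∀ w : HeightOneSpectrum (𝓞 K), w ∉ S → InvLevelLaw inv (Sum.inr w : Place K))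
    (hUO : ∀ k, (inv k).UnramifiedOrthogonal)
    (hSp : ∀ w : HeightOneSpectrum (𝓞 K), ((p : ℕ) : 𝓞 K) ∈ w.asIdeal → w ∈ S)
    (hram : ∀ w : HeightOneSpectrum (𝓞 K), w ∉ S → ∀ k, GaloisRep.IsUnramifiedAt w (E.layerRep k))
    (y : continuousCohomology 1 E.dualSystem.limitRep.toTopRep)
    (hSig : ∀ v : Place K, InSigma S v → E.locDual (absGaloisRestrict K (Place.Completion v)) y = 0)
    (hoff : ∀ w : HeightOneSpectrum (𝓞 K), w ∉ S →
      E.locDual (absGaloisRestrict K (Place.Completion (Sum.inr w : Place K))) y ∈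
        E.dualLocalCondition inv (Sum.inr w) (unramifiedSubgroup (GaloisRep.toLocal w τ) 1))
    (k : ℕ) : cohomologyMap (E.dualSystem.projHom k) 1 y ∈ shaOneDualLevel S E k := by
  refine ⟨fun v hv => ?_, fun w hw => ?_⟩
  · have h := E.localProj_locDual v k y
    rw [hSig v hv, map_zero] at h
    exact h.symm
  · have hpw : (((p ^ k : ℕ) : ℕ) : 𝓞 K) ∉ w.asIdeal := by
      rw [Nat.cast_pow]
      exact fun h => hw (hSp w (w.isPrime.mem_of_pow_mem k h))
    have horth := (hUO k (E.layerRep k) (fun m => E.pow_smul_eq_zero m) w hpw (hram w hw k)).1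
    have hk := (locDual_mem_dualLocalCondition_iff (hinv w hw) _ y).1 (hoff w hw) k
    have hle : unramifiedSubgroup (GaloisRep.toLocal w (E.layerRep k)) 1 ≤
        (unramifiedSubgroup (GaloisRep.toLocal w τ) 1).comap (E.localSubtypeMap (Sum.inr w) k) :=
      fun a ha => galoisCohomology.map_unramifiedSubgroup_le (τ := GaloisRep.toLocal w (E.layerRep k))
        (τ' := GaloisRep.toLocal w τ)
        ((E.layerSubtypeHom k).hom.restrictField (Place.Completion (Sum.inr w : Place K))) ⟨a, ha, rfl⟩
    have hk' := (inv k).dualLocalCondition_anti (E.layerRep k) (Sum.inr w) hle hk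
    rw [horth] at hk'
    exact hk'

end Literature.NumberTheory.IwasawaTheory.Greenberg2016
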